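import Mathlib.Algebra.Order.Antidiag.Finsupp
import Mathlib.RingTheory.Polynomial.Resultant.Basic
import Mathlib.RingTheory.MvPolynomial.Homogeneous
import Mathlib.Algebra.MvPolynomial.PDeriv
import HarnessLib

/-!
# Towards Kaltofen's Theorem 7 (effective Noether forms): the generic objects of §5

Definitions file for the assembly of the named fact
`Literature.RingTheory.MvPolynomial.kaltofen1995_thm7` (E. Kaltofen, *Effective Noether
irreducibility forms and applications*, J. Comput. System Sci. 50 (1995) 274–295, §5, proof of
Thm. 7, pp. 24–25). Kaltofen writes the degree-`d` polynomial in `n` variables generically,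
`f = Σ_{|e| ≤ d} c_e X^e` over `E = ℤ[…, c_e, …]`, substitutes generic affine-linear forms in two
new variables `x, y` for the `Xᵢ`, and builds his irreducibility forms `Φ_t = c_e σ τ` (34) out
of three sets: `S₁ = {c_e : |e| = d}`, `S₂ =` the coefficients (with respect to the substitution
parameters) of the generic discriminant `ρ̄`, and `S₃ =` the coefficients of the denominator-free
evaluations `λ^D Δ` of the bivariate forms `Δ` of Thm. 4 at the coefficients of the substituted
polynomial. This file fixes these objects in Lean (data only; all theorems about them live in the
sibling `…Proofs` files):

* `Params n = Fin n ⊕ (Fin n ⊕ Fin n)` — the `3n` substitution parameters `z` (= `inl`),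
  `μ` (= `inr inl`), `v` (= `inr inr`) of the substitution `Xᵢ ↦ μᵢ + vᵢ x + zᵢ y` (the tree's
  Bertini-file shape; Kaltofen's `Xᵢ ↦ vᵢ + wᵢ x + zᵢ y` with `w₁ = 1`, `z₁ = 0` is a
  specialisation, and nothing in Thm. 7 depends on the choice);
* `GenRing n = ℤ[params][c_e : e]` — generic coefficients `c_e = X e` as OUTER variables over
  the parameter ring, so that "degree in the `c`'s" (Kaltofen's `deg_{c's}`) is `totalDegree`;
* `exps n d`, `topExps n d` — exponents of total degree `≤ d` / `= d`;
* `fgen n d = Σ_{|e| ≤ d} c_e X^e`, `gline` (`= fgen(μ + xv)`), `planeGen` (`= fgen(μ + vx + zy)`),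
  `lam` (`λ = fgen_d(v)`, the leading `x`-coefficient), `rhoBar` (`ρ̄ = Res_x^{d,d-1}(g, ∂g/∂x)`,
  Kaltofen's `λ^{2d-1}ρ`), `bivCoeff` (the coefficients `N_b` of `x^{b₁}y^{b₂}` in `planeGen`),
  `clearedEval D Δ = Σ_k λ^{D-k} Δ_k(N)` (`= λ^D Δ(N/λ)`, Kaltofen's `λ^D Δ'`),
  `extract F m` (the `c`-polynomial coefficient of the parameter monomial `m` in `F`, i.e. the
  elements `σ`, `τ` of `S₂`, `S₃`), `extractSupport`, and the specialisation `spec q` at a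
  coefficient vector `q` over a ring `K` (`c_e ↦ q_e`, parameters kept).

## References

* E. Kaltofen, J. Comput. System Sci. 50 (1995) 274–295, §4 (30)–(31), §5 proof of Thm. 7.
  [Kaltofen1995]
-/

noncomputable section

open MvPolynomial
open scoped Polynomial

namespace Literature.RingTheory.MvPolynomial

/-- The `3n` substitution parameters: `z = inl`, `μ = inr ∘ inl`, `v = inr ∘ inr`.
[cite: Kaltofen1995, §5 (the indeterminates v, w, z)] -/
abbrev KaltofenGeneric.Params (n : ℕ) : Type := Fin n ⊕ (Fin n ⊕ Fin n)

/-- Kaltofen's generic coefficient ring `E[v, w, z] = ℤ[…, c_e, …][v, w, z]`, arranged as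
`ℤ[params][c_e]` with the generic coefficients `c_e = X e` (`e : Fin n →₀ ℕ`) as outer
variables. [cite: Kaltofen1995, §5 proof of Thm. 7 (the ring E)] -/
abbrev KaltofenGeneric.GenRing (n : ℕ) : Type :=
  MvPolynomial (Fin n →₀ ℕ) (MvPolynomial (KaltofenGeneric.Params n) ℤ)

namespace KaltofenGeneric

variable (n d : ℕ)

/-! ### Exponent sets -/

/-- Exponent vectors of total degree `≤ d` in `n` variables. [folklore] -/
def exps : Finset (Fin n →₀ ℕ) :=
  (Finset.range (d + 1)).biUnion fun k => (Finset.univ : Finset (Fin n)).finsuppAntidiag k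

/-- Exponent vectors of total degree exactly `d` (the index set of `S₁`). [cite: Kaltofen1995, §5 (34), S₁] -/
def topExps : Finset (Fin n →₀ ℕ) :=
  (Finset.univ : Finset (Fin n)).finsuppAntidiag d

variable {n d}

/-- Bookkeeping for the generic objects of Kaltofen's §5: `mem_exps`. [folklore] -/
theorem mem_exps {e : Fin n →₀ ℕ} : e ∈ exps n d ↔ (e.sum fun _ k => k) ≤ d := by
  classical
  simp only [exps, Finset.mem_biUnion, Finset.mem_range, Finset.mem_finsuppAntidiag',
    Finset.subset_univ, and_true]
  constructor
  · rintro ⟨k, hk, rfl⟩; omega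
  · intro h; exact ⟨_, by omega, rfl⟩

/-- Bookkeeping for the generic objects of Kaltofen's §5: `mem_topExps`. [folklore] -/
theorem mem_topExps {e : Fin n →₀ ℕ} : e ∈ topExps n d ↔ (e.sum fun _ k => k) = d := by
  classical
  simp only [topExps, Finset.mem_finsuppAntidiag', Finset.subset_univ, and_true]

/-- Bookkeeping for the generic objects of Kaltofen's §5: `topExps_subset_exps`. [folklore] -/
theorem topExps_subset_exps : topExps n d ⊆ exps n d := fun e he => by
  rw [mem_topExps] at he; rw [mem_exps]; omega

variable (n d)

/-! ### The generic polynomial and its substitutions -/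

/-- The generic polynomial of degree `≤ d`: `f = Σ_{|e| ≤ d} c_e X^e` with indeterminate
coefficients `c_e`. [cite: Kaltofen1995, §5 proof of Thm. 7] -/
def fgen : MvPolynomial (Fin n) (GenRing n) :=
  ∑ e ∈ exps n d, monomial e (X e)

/-- The parameters `zᵢ` (coefficients of `y`). [cite: Kaltofen1995, §5] -/
def zv (i : Fin n) : GenRing n := C (X (Sum.inl i))

/-- The parameters `μᵢ` (translation). [cite: Kaltofen1995, §5] -/
def μv (i : Fin n) : GenRing n := C (X (Sum.inr (Sum.inl i)))

/-- The parameters `vᵢ` (coefficients of `x`, the line direction). [cite: Kaltofen1995, §5] -/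
def vv (i : Fin n) : GenRing n := C (X (Sum.inr (Sum.inr i)))

/-- The generic line restriction `g(x) = f(μ + xv)` (`= φ₂(x, 0)`), whose discriminant is
Kaltofen's `ρ̄`. [cite: Kaltofen1995, §4 (31), §5] -/
def gline : Polynomial (GenRing n) :=
  MvPolynomial.aeval (fun i ↦ Polynomial.C (μv n i) + Polynomial.C (vv n i) * Polynomial.X :
    Fin n → Polynomial (GenRing n)) (fgen n d)

/-- The generic plane section `φ₂(x, y) = f(μ + vx + zy) ∈ E[params][y][x]` (outer variable
`x`, inner `y`). [cite: Kaltofen1995, §5 (φ₂)] -/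
def planeGen : Polynomial (Polynomial (GenRing n)) :=
  MvPolynomial.aeval (fun i ↦
    (Polynomial.C (Polynomial.C (μv n i)) + Polynomial.C (Polynomial.C (vv n i)) * Polynomial.X +
      Polynomial.C (Polynomial.C (zv n i) * Polynomial.X) : Polynomial (Polynomial (GenRing n))))
    (fgen n d)

/-- The generic leading `x`-coefficient `λ = f_d(v) = Σ_{|e| = d} c_e v^e` (Kaltofen's (30)).
[cite: Kaltofen1995, §4 (30)] -/
def lam : GenRing n :=
  ∑ e ∈ topExps n d, X e * ∏ i, vv n i ^ e i

/-- The generic discriminant `ρ̄ = Res_x^{d,d-1}(g, ∂g/∂x)` (for `g = λψ(x, 0, …, 0)` this is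
Kaltofen's `λ^{2d-1}ρ`, the numerator of the generic `r` of (31)). [cite: Kaltofen1995, §4 (31), §5 (ρ̄)] -/
def rhoBar : GenRing n :=
  Polynomial.resultant (gline n d) (Polynomial.derivative (gline n d)) d (d - 1)

/-- The coefficient `N_b` of `x^{b₁} y^{b₂}` in `φ₂` (so that `ψ₂ = φ₂/λ` has coefficients
`N_b/λ`). [cite: Kaltofen1995, §5 (ψ₂ := φ₂/ldcf_x(φ₂))] -/
def bivCoeff (b : ℕ × ℕ) : GenRing n :=
  ((planeGen n d).coeff b.1).coeff b.2

/-- The denominator-free evaluation `λ^D Δ'` of a bivariate form `Δ` of degree `≤ D` at the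
coefficients `N_b/λ` of `ψ₂`: `Σ_k λ^{D-k} Δ_k(N)`, `Δ_k` the homogeneous components.
[cite: Kaltofen1995, §5 (λ^D Δ'_s)] -/
def clearedEval (D : ℕ) (Δ : MvPolynomial (ℕ × ℕ) ℤ) : GenRing n :=
  ∑ k ∈ Finset.range (D + 1),
    lam n d ^ (D - k) * MvPolynomial.aeval (bivCoeff n d) (homogeneousComponent k Δ)

variable {n}

/-- The `c`-polynomial coefficient of the parameter monomial `m` in `F ∈ ℤ[params][c]`: the
elements `σ ∈ S₂`, `τ ∈ S₃` are `extract ρ̄ m`, `extract (λ^D Δ') m`. [cite: Kaltofen1995, §5 (34), S₂ and S₃] -/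
def extract (F : GenRing n) (m : Params n →₀ ℕ) : MvPolynomial (Fin n →₀ ℕ) ℤ :=
  ∑ e ∈ F.support, monomial e (coeff m (coeff e F))

/-- A finite set of parameter monomials outside of which `extract F m = 0`. [folklore] -/
def extractSupport (F : GenRing n) : Finset (Params n →₀ ℕ) :=
  F.support.biUnion fun e => (coeff e F).support

/-- Specialisation of the generic coefficients at a coefficient vector `q` over a ring `K`,
keeping the parameters: `c_e ↦ q_e`, `params ↦ params`. [cite: Kaltofen1995, §5 ("substitute its coefficients q_e for the c_e")] -/
def spec {K : Type*} [CommRing K] (q : (Fin n →₀ ℕ) → K) : GenRing n →+* MvPolynomial (Params n) K :=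
  MvPolynomial.eval₂Hom (MvPolynomial.map (Int.castRingHom K)) fun e => C (q e)

/-! ### Coefficient norms (Kaltofen's `‖·‖₁` bookkeeping, §3 and §5)

Kaltofen measures every intermediate object by the 1-norm of its integer coefficient vector
("we use 1-norms of multivariate polynomials over ℤ, which for a given polynomial are defined as
the sum of the absolute values of its integral coefficients", §3 p. 10). For polynomials with
coefficients in a ring `R` already carrying such a norm `ν : R → ℕ` we use the sums of the norms
of the coefficients. -/

/-- Sum of the norms of the coefficients of a univariate polynomial. [cite: Kaltofen1995, §3 (1-norms)] -/
def polyNorm {R : Type*} [Semiring R] (ν : R → ℕ) (p : Polynomial R) : ℕ :=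
  ∑ i ∈ p.support, ν (p.coeff i)

/-- Sum of the norms of the coefficients of a multivariate polynomial. [cite: Kaltofen1995, §3 (1-norms)] -/
def mvNorm {R : Type*} [CommSemiring R] {σ : Type*} (ν : R → ℕ) (p : MvPolynomial σ R) : ℕ :=
  ∑ m ∈ p.support, ν (coeff m p)

/-! ### Unfolding lemmas -/

/-- Bookkeeping for the generic objects of Kaltofen's §5: `spec_X`. [folklore] -/
@[simp] theorem spec_X {K : Type*} [CommRing K] (q : (Fin n →₀ ℕ) → K) (e : Fin n →₀ ℕ) :
    spec q (X e) = C (q e) := by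
  simp [spec]

/-- Bookkeeping for the generic objects of Kaltofen's §5: `spec_C`. [folklore] -/
@[simp] theorem spec_C {K : Type*} [CommRing K] (q : (Fin n →₀ ℕ) → K) (p : MvPolynomial (Params n) ℤ) :
    spec q (C p) = MvPolynomial.map (Int.castRingHom K) p := by
  simp [spec]

/-- Bookkeeping for the generic objects of Kaltofen's §5: `spec_zv`. [folklore] -/
@[simp] theorem spec_zv {K : Type*} [CommRing K] (q : (Fin n →₀ ℕ) → K) (i : Fin n) :
    spec q (zv n i) = X (Sum.inl i) := by
  simp [zv]

/-- Bookkeeping for the generic objects of Kaltofen's §5: `spec_μv`. [folklore] -/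
@[simp] theorem spec_μv {K : Type*} [CommRing K] (q : (Fin n →₀ ℕ) → K) (i : Fin n) :
    spec q (μv n i) = X (Sum.inr (Sum.inl i)) := by
  simp [μv]

/-- Bookkeeping for the generic objects of Kaltofen's §5: `spec_vv`. [folklore] -/
@[simp] theorem spec_vv {K : Type*} [CommRing K] (q : (Fin n →₀ ℕ) → K) (i : Fin n) :
    spec q (vv n i) = X (Sum.inr (Sum.inr i)) := by
  simp [vv]

/-- Bookkeeping for the generic objects of Kaltofen's §5: `coeff_extract`. [folklore] -/
theorem coeff_extract (F : GenRing n) (m : Params n →₀ ℕ) (e : (Fin n →₀ ℕ) →₀ ℕ) :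
    coeff e (extract F m) = coeff m (coeff e F) := by
  classical
  rw [extract, coeff_sum]
  simp only [coeff_monomial]
  rw [Finset.sum_ite_eq']
  split_ifs with h
  · rfl
  · rw [notMem_support_iff.1 h, coeff_zero]

/-- Bookkeeping for the generic objects of Kaltofen's §5: `extract_eq_zero_of_notMem`. [folklore] -/
theorem extract_eq_zero_of_notMem {F : GenRing n} {m : Params n →₀ ℕ} (hm : m ∉ extractSupport F) :
    extract F m = 0 := by
  classical
  ext e
  rw [coeff_extract, coeff_zero]
  by_contra h
  exact hm (Finset.mem_biUnion.2 ⟨e, mem_support_iff.2 (fun h0 => h (by rw [h0, coeff_zero])),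
    mem_support_iff.2 h⟩)

end KaltofenGeneric

end Literature.RingTheory.MvPolynomial

end
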